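import Summits.NavierStokesRegularity.NavierStokesRegularity.Theses.QuantisedSymmetry
import Summits.NavierStokesRegularity.NavierStokesRegularity.Theses.Blowup
import Summits.NavierStokesRegularity.NavierStokesRegularity.Theses.AncientHullSteering
import Summits.NavierStokesRegularity.NavierStokesRegularity.Theses.FilamentSkeletonRss
import Summits.NavierStokesRegularity.NavierStokesRegularity.Theorems.QuantisedSymmetryPolyhedralTruncationBridge
import Summits.NavierStokesRegularity.NavierStokesRegularity.Theorems.QuantisedSymmetryLiouvilleKillsProfile
import Summits.NavierStokesRegularity.NavierStokesRegularity.Theorems.QuantisedSymmetryPolyhedralDssProfileExistsDominatesBlowupProfile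
import Summits.NavierStokesRegularity.NavierStokesRegularity.Theorems.FilamentSkeletonRssRdssProfileTruncation

/-!
# Strategist companion s15-g4 for crux `PolyhedralDssProfileExists` (stmt-NavierStokesRegularity-1404)

Typed, sorry-free certificate for the strategy census `STRATEGY-CENSUS-s15.md` (family `s`, gen 4,
independent). It records, over the tree's own declarations:

* §1 `crux_decides` — the crux ALONE implies `¬ NavierStokesRegularity` by LANDED theorems
  (bridge stmt-11331 and Clay uniqueness stmt-0153 are proved), so every candidate replacement of the
  crux lies in the interval `[¬S, C]`;
* §2 the lattice of strictly-weaker intermediates obtained by stripping structure from `C`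
  (`C → DssProfileExists → RdssProfileExists ↔ Blowup.BlowupTypeIDssProfile → Blowup.BlowupExists → ¬S`),
  each of which is ALSO summit-deciding by landed theorems (so "weaker" buys nothing short of the
  summit), and the genuinely weaker `¬PolyhedralTypeILiouville → AncientHullSteering.SelfExcitedTypeIProfile`
  which decides the summit only through the OPEN bridge stmt-20185;
* §3 the best typed split (`HullRecurrence ∧ ¬PolyhedralTypeILiouville → C`) with its modus-ponens
  assembly proved — recorded so the census can say precisely which piece stays crux-hard;
* §4 a strengthening `S⁺` (central-inversion-odd profiles) with `S⁺ → C`.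

Nothing here is a proof attempt on the crux; no `sorry`.
-/

noncomputable section

open MeasureTheory Set

namespace Summit.NavierStokesRegularity.NavierStokesRegularity.Cruxes.PolyhedralDssProfileExists.S15g4

open Literature.Analysis.FluidPDE
open Summit.NavierStokesRegularity.NavierStokesRegularity.Theses

/-- Local notation for physical space. -/
local notation "ℝ³" => EuclideanSpace ℝ (Fin 3)

/-! ## §1 The crux decides the summit by landed theorems -/

/-- `C → ¬S` with NO open hypothesis: the route's `closes` fed with the landed bridge
`quantisedSymmetry_polyhedralTruncationBridge_proof` (stmt-11331) and `ClayUniqueness_holds` (stmt-0153). -/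
theorem crux_decides :
    QuantisedSymmetry.PolyhedralDssProfileExists → ¬ _root_.NavierStokesRegularity :=
  fun hX => QuantisedSymmetry.closes hX
    Summit.NavierStokesRegularity.NavierStokesRegularity.Theorems.quantisedSymmetry_polyhedralTruncationBridge_proof
    QuantisedSymmetry.ClayUniqueness_holds

/-! ## §2 Weaker intermediates (structure stripped from `C`) -/

/-- W1: a nontrivial ancient mild Type-I `c`-DSS profile, NO symmetry group. -/
def DssProfileExists : Prop :=
  ∃ c : ℝ, 1 < c ∧ ∃ u : ℝ → ℝ³ → ℝ³, IsAncientMildSolution 1 u ∧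
    (∀ t < 0, AEStronglyMeasurable (u t) volume) ∧ IsDiscretelySelfSimilar c u ∧
    (∃ C₀ : ℝ, HasTypeIDecay C₀ u) ∧ ¬ (∀ t < 0, u t =ᵐ[volume] 0)

/-- W1ᴿ: a nontrivial ancient mild Type-I ROTATED `c`-DSS profile — literally the antecedent of
`FilamentSkeletonRss.RdssProfileTruncation` (stmt-11289, proved). -/
def RdssProfileExists : Prop :=
  ∃ (c : ℝ) (R : ℝ³ ≃ₗᵢ[ℝ] ℝ³) (u : ℝ → ℝ³ → ℝ³), 1 < c ∧ IsAncientMildSolution 1 u ∧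
    (∀ t < 0, AEStronglyMeasurable (u t) volume) ∧ IsRotatedDSS c R u ∧
    (∃ C₀ : ℝ, HasTypeIDecay C₀ u) ∧ ¬ (∀ t < 0, u t =ᵐ[volume] 0)

theorem dss_of_crux : QuantisedSymmetry.PolyhedralDssProfileExists → DssProfileExists := by
  rintro ⟨-, -, -, -, c, hc, u, hanc, hmeas, hdss, hdec, -, hnt⟩
  exact ⟨c, hc, u, hanc, hmeas, hdss, hdec, hnt⟩

theorem rdss_of_dss : DssProfileExists → RdssProfileExists := by
  rintro ⟨c, hc, u, hanc, hmeas, hdss, hdec, hnt⟩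
  exact ⟨c, LinearIsometryEquiv.refl ℝ ℝ³, u, hc, hanc, hmeas, isRotatedDSS_refl_iff.mpr hdss, hdec, hnt⟩

/-- W1ᴿ is exactly Blowup #5 (stmt-0155, the negation of Tsai's Type-I (R)DSS Liouville conjecture). -/
theorem rdss_iff_blowupTypeIDssProfile : RdssProfileExists ↔ Blowup.BlowupTypeIDssProfile := by
  constructor
  · rintro ⟨c, R, u, hc, hanc, hmeas, hr, hdec, hnt⟩ hall
    exact hnt ((hall c).2 R hc u hanc hmeas hr hdec)
  · intro hW
    by_contra h
    apply hW
    intro c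
    refine ⟨fun hc u hanc hmeas hdss hdec => ?_, fun R hc u hanc hmeas hr hdec => ?_⟩
    · by_contra hnt
      exact h ⟨c, LinearIsometryEquiv.refl ℝ ℝ³, u, hc, hanc, hmeas,
        isRotatedDSS_refl_iff.mpr hdss, hdec, hnt⟩
    · by_contra hnt
      exact h ⟨c, R, u, hc, hanc, hmeas, hr, hdec, hnt⟩

/-- W1ᴿ → X5a (finite-time blow-up of a Leray–Hopf classical solution from a rapidly decaying datum)
by the LANDED rotated truncation bridge (subcritical quasi-compact steering, stmt-11289). -/
theorem blowupExists_of_rdss : RdssProfileExists → Blowup.BlowupExists := fun h =>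
  Summit.NavierStokesRegularity.NavierStokesRegularity.Theorems.filamentSkeletonRss_rdssProfileTruncation_proof h

/-- X5a → ¬S (Blowup route's `closes` with the landed Clay uniqueness). -/
theorem not_nsr_of_blowupExists : Blowup.BlowupExists → ¬ _root_.NavierStokesRegularity := fun h =>
  Blowup.closes h
    _root_.Summit.NavierStokesRegularity.NavierStokesRegularity.Theorems.adiabaticEddy_clayUniqueness_proof

/-- Hence every structure-stripped intermediate is itself summit-deciding by landed theorems. -/
theorem dss_decides : DssProfileExists → ¬ _root_.NavierStokesRegularity :=
  fun h => not_nsr_of_blowupExists (blowupExists_of_rdss (rdss_of_dss h))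

theorem rdss_decides : RdssProfileExists → ¬ _root_.NavierStokesRegularity :=
  fun h => not_nsr_of_blowupExists (blowupExists_of_rdss h)

theorem blowupTypeIDssProfile_decides : Blowup.BlowupTypeIDssProfile → ¬ _root_.NavierStokesRegularity :=
  fun h => rdss_decides (rdss_iff_blowupTypeIDssProfile.mpr h)

/-- The chain `C → W1 → W1ᴿ → X5a`, composed. -/
theorem blowupExists_of_crux : QuantisedSymmetry.PolyhedralDssProfileExists → Blowup.BlowupExists :=
  fun h => blowupExists_of_rdss (rdss_of_dss (dss_of_crux h))

/-! ### The genuinely weaker level: drop discrete self-similarity (bounded ancient Type-I objects) -/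

/-- W4 := ¬(kill switch #3): `C → ¬PolyhedralTypeILiouville` (landed glue stmt-1408). -/
theorem not_polyhedralLiouville_of_crux :
    QuantisedSymmetry.PolyhedralDssProfileExists → ¬ QuantisedSymmetry.PolyhedralTypeILiouville :=
  fun hC h3 =>
    Summit.NavierStokesRegularity.NavierStokesRegularity.Theorems.quantisedSymmetry_liouvilleKillsProfile_proof h3 hC

/-- W4 → W3: a G-equivariant nontrivial bounded ancient Type-I solution is in particular a nontrivial
bounded ancient Type-I solution (AncientHullSteering crux stmt-20186). -/
theorem selfExcited_of_not_polyhedralLiouville :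
    ¬ QuantisedSymmetry.PolyhedralTypeILiouville → AncientHullSteering.SelfExcitedTypeIProfile := by
  intro hn hall
  apply hn
  intro G _ _ _ u hb hmeas hdec _
  exact hall u hb hmeas hdec

theorem selfExcited_of_crux :
    QuantisedSymmetry.PolyhedralDssProfileExists → AncientHullSteering.SelfExcitedTypeIProfile :=
  fun h => selfExcited_of_not_polyhedralLiouville (not_polyhedralLiouville_of_crux h)

/-- W3 decides the summit ONLY through the OPEN bridge `AncientTruncationBridge` (stmt-20185, XL):
this is `AncientHullSteering.closes`, restated to make the open hypothesis explicit. -/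
theorem selfExcited_decides_given_bridge (hR : AncientHullSteering.AncientTruncationBridge) :
    AncientHullSteering.SelfExcitedTypeIProfile → ¬ _root_.NavierStokesRegularity :=
  fun hP => AncientHullSteering.closes hR hP

/-! ## §3 Best typed split: hull recurrence × failure of the kill switch -/

/-- `HullRecurrence` (piece R of split D_hull): every chiral-polyhedral symmetry class that carries a
nontrivial bounded ancient Type-I solution also carries a nontrivial Type-I `c`-DSS ancient mild one
("the scaling hull of a self-excited profile contains a periodic point"). An UNFOUNDED dynamical
claim — recorded only to show the shape of the split and which piece stays hard. -/
def HullRecurrence : Prop :=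
  ∀ G : Subgroup (ℝ³ ≃ₗᵢ[ℝ] ℝ³), Finite G →
    (∀ g ∈ G, LinearMap.det (g.toLinearEquiv : ℝ³ →ₗ[ℝ] ℝ³) = 1) →
    (∀ V : Submodule ℝ ℝ³, (∀ g ∈ G, ∀ v ∈ V, g v ∈ V) → V = ⊥ ∨ V = ⊤) →
    (∃ u : ℝ → ℝ³ → ℝ³, IsBoundedAncientMildSolution 1 u ∧ (∀ t < 0, AEStronglyMeasurable (u t) volume) ∧
      (∃ C₀ : ℝ, HasTypeIDecay C₀ u) ∧ (∀ g ∈ G, ∀ t x, u t (g x) = g (u t x)) ∧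
      ¬ (∀ t < 0, u t =ᵐ[volume] 0)) →
    ∃ c : ℝ, 1 < c ∧ ∃ u : ℝ → ℝ³ → ℝ³, IsAncientMildSolution 1 u ∧
      (∀ t < 0, AEStronglyMeasurable (u t) volume) ∧ IsDiscretelySelfSimilar c u ∧
      (∃ C₀ : ℝ, HasTypeIDecay C₀ u) ∧ (∀ g ∈ G, ∀ t x, u t (g x) = g (u t x)) ∧
      ¬ (∀ t < 0, u t =ᵐ[volume] 0)

/-- Assembly of split D_hull (modus ponens): `¬#3 ∧ HullRecurrence → C`. -/
theorem crux_of_hull_split (hn : ¬ QuantisedSymmetry.PolyhedralTypeILiouville) (hR : HullRecurrence) :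
    QuantisedSymmetry.PolyhedralDssProfileExists := by
  by_contra hC
  apply hn
  intro G hfin hdet hirr u hb hmeas hdec heqv
  by_contra hnt
  obtain ⟨c, hc, w, hw⟩ := hR G hfin hdet hirr ⟨u, hb, hmeas, hdec, heqv, hnt⟩
  exact hC ⟨G, hfin, hdet, hirr, c, hc, w, hw⟩

/-! ## §4 A strengthening `S⁺` (more rigid class) and the trivial direction `S⁺ → C` -/

/-- `S⁺_odd`: the crux with, in addition, equivariance under the central inversion `x ↦ −x`
(profiles of the full group `G × {±1}`: `T_h`, `O_h`, `I_h`; Kida–Pelz-type mirror classes lie here). -/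
def OddPolyhedralDssProfileExists : Prop :=
  ∃ G : Subgroup (ℝ³ ≃ₗᵢ[ℝ] ℝ³), Finite G ∧
    (∀ g ∈ G, LinearMap.det (g.toLinearEquiv : ℝ³ →ₗ[ℝ] ℝ³) = 1) ∧
    (∀ V : Submodule ℝ ℝ³, (∀ g ∈ G, ∀ v ∈ V, g v ∈ V) → V = ⊥ ∨ V = ⊤) ∧
    ∃ c : ℝ, 1 < c ∧ ∃ u : ℝ → ℝ³ → ℝ³, IsAncientMildSolution 1 u ∧
      (∀ t < 0, AEStronglyMeasurable (u t) volume) ∧ IsDiscretelySelfSimilar c u ∧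
      (∃ C₀ : ℝ, HasTypeIDecay C₀ u) ∧ (∀ g ∈ G, ∀ t x, u t (g x) = g (u t x)) ∧
      (∀ t x, u t (-x) = -(u t x)) ∧ ¬ (∀ t < 0, u t =ᵐ[volume] 0)

theorem crux_of_odd : OddPolyhedralDssProfileExists → QuantisedSymmetry.PolyhedralDssProfileExists := by
  rintro ⟨G, hfin, hdet, hirr, c, hc, u, hanc, hmeas, hdss, hdec, heqv, -, hnt⟩
  exact ⟨G, hfin, hdet, hirr, c, hc, u, hanc, hmeas, hdss, hdec, heqv, hnt⟩

end Summit.NavierStokesRegularity.NavierStokesRegularity.Cruxes.PolyhedralDssProfileExists.S15g4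

end
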